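import Summits.BirchSwinnertonDyer.BirchSwinnertonDyer.Theorems.BiquadraticEisensteinDescentHeegnerTwistCouplingInSupplyPartnerLadder
import Summits.BirchSwinnertonDyer.BirchSwinnertonDyer.Theorems.BiquadraticEisensteinDescentHeegnerTwistCouplingInSupplyQuarticMinusTripleCorner
import Summits.BirchSwinnertonDyer.BirchSwinnertonDyer.Theorems.BiquadraticEisensteinDescentHeegnerTwistCouplingInSupplyNonresidueCell
import HarnessLib

set_option linter.dupNamespace false -- `Summit.BirchSwinnertonDyer.BirchSwinnertonDyer.Theorems.…` (summit = sub, D-0017)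
set_option autoImplicit false

/-!
# Crux `HeegnerTwistCouplingInSupply` (stmt-BirchSwinnertonDyer-21381), card `class-number-switch-duke-bilinear` —
# the CORNER COMPOSITION (the card's `FirstLemma`): both cells ⟹ the crux's conclusion on `W = E_p`, and the switch

Route `BiquadraticEisensteinDescent` (cell `pub/bsd-wall`; width seat `bsd-wall-cm-bed-w4` g25; theorems only,
`--supports 21381`). Sequel of `…NonresidueCell.lean` / `…ResiduePin.lean`. The card's glue «in the style of
`analyticRank_eq_zero_odd_five` + `exists_witnessField…`», made a kernel theorem:

* §1 `analyticRank_eq_zero_of_det_odd_four` — the journal door for FOUR odd primes (`Monsky + det M = 1 + Burungale–Tian +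
  Deuring–Hecke + Burungale–Flach ⟹ E_{a(b(cd))}` has analytic rank `0` and `L ≠ 0`), the `k = 4` twin of the tree's
  `…ThreeSquaresPinRankZero.analyticRank_eq_zero_of_det_odd`.
* §2 ★ `cruxConclusion_caseA` — Case A of the card at ONE prime `p ≡ 7 (mod 8)`: a `(3,+)` prime `ℓ₃` (the Duke pin, here a
  hypothesis) with the size condition `π⁻¹·√(2pℓ₃)·log(2pℓ₃) < p`, together with the tree's Siegel-free `(5,−)` prime
  `ℓ₅ < 2p` (`…ThreeSquaresPin.threeSquaresPin`) and the universal cell `det M(p, ℓ₃, ℓ₅) = 1`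
  (`…MonskyCells.det_monskyMatrixOdd_cell_seven_mod_eight`), gives the conclusion of `HeegnerTwistCouplingInSupply` at
  `(E_p, p)` with `K′ = ℚ(√−ℓ₃ℓ₅)`, `h(K′) < p`.
* §3 ★ `cruxConclusion_caseB` — Case B at ONE `p`: an all-nonresidue triple `ℓ₁ ≡ 1, ℓ₃ ≡ 3, ℓ₅ ≡ 5 (mod 8)`, `(ℓᵢ/p) = −1`,
  `(ℓ₁/ℓ₃) = +1` (the Heath-Brown bilinear supply, here a hypothesis) with `π⁻¹·√(ℓ₁ℓ₃ℓ₅)·log(ℓ₁ℓ₃ℓ₅) < p`, and the cell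
  `…NonresidueCell.det_monskyMatrixOdd_nonresidueCell`, gives the conclusion with `K′ = ℚ(√−ℓ₁ℓ₃ℓ₅)`.
* §4 ★ `epCornerAllLargeP_of_supplies` — the SWITCH: for any predicate `C` on `p` (the card: `h(−4p) ≥ p^{1/2−η}`), supply A
  beyond `p₀` under `C p` and supply B beyond `p₀′` under `¬ C p` give the card's target `EpCornerAllLargeP` — the crux's
  conclusion (with `h(K′) < p`) for EVERY prime `p ≡ 7 (mod 8)` beyond `max p₀ p₀′`, with NO side condition on `p mod 3, 5`
  — modulo the five named facts of `cruxOnEpCorner_of_facts` (Modularity, Monsky odd, Burungale–Tian, Deuring–Hecke,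
  Burungale–Flach), all hypotheses BY NAME.

HONEST FRAMING: glue only. The two SUPPLIES (DUKE-A in the size-effective form of §2's hypothesis; HB95 in §3's) are research /
print inputs NOT proved here; the five named facts are hypotheses; crux 21381 and BSD are NOT proved. No definition, no named
fact, no `sorry`; axioms standard.
[cite: HeathBrown1994SelmerCongruentII, Appendix (Monsky), typescript p. 39 L10–L33] [cite: BurungaleTian2026, Thm. 1.1]
[cite: BurungaleFlach2024, Thm. 1.1 and Cor. 2] [cite: KoblitzECMF1993, Ch. II §5, Theorem (p. 84)]
[cite: Oesterle1988Gauss, II §3 Proposition p. 57 (27)] [cite: Marcus2018, Ch. 2 Thm. 1; Ch. 3 Thm. 25]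
-/

namespace Summit.BirchSwinnertonDyer.BirchSwinnertonDyer.Theorems.DukeBilinearCells

open Literature.NumberTheory.EllipticCurves Literature.NumberTheory.EllipticCurves.HeathBrown1994
  Literature.NumberTheory.EllipticCurves.HeathBrown1994.Families
  Literature.NumberTheory.QuadraticFields Literature.NumberTheory.QuadraticFields.Quadratic
open Summit.BirchSwinnertonDyer.BirchSwinnertonDyer.Theorems.BiquadraticEisensteinDescentHeegnerTwistCouplingInSupplyMonskyCells
  Summit.BirchSwinnertonDyer.BirchSwinnertonDyer.Theorems.BiquadraticEisensteinDescentHeegnerTwistCouplingInSupplyThreeSquaresPin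
  Summit.BirchSwinnertonDyer.BirchSwinnertonDyer.Theorems.BiquadraticEisensteinDescentHeegnerTwistCouplingInSupplyThreeSquaresPinRankZero
  Summit.BirchSwinnertonDyer.BirchSwinnertonDyer.Theorems.BiquadraticEisensteinDescentHeegnerTwistCouplingInSupplyThreeSquaresPinCorner
  Summit.BirchSwinnertonDyer.BirchSwinnertonDyer.Theorems.BiquadraticEisensteinDescentHeegnerTwistCouplingInSupplyPartnerLadder
  Summit.BirchSwinnertonDyer.BirchSwinnertonDyer.Theorems.BiquadraticEisensteinDescentHeegnerTwistCouplingInSupplyQuarticMinusTripleCorner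

/-! ## §1 The journal door for four odd primes -/

/-- `![a, b, c, d]` is injective for pairwise distinct entries. [folklore] -/
theorem vecFour_injective {a b c d : ℕ} (hab : a ≠ b) (hac : a ≠ c) (had : a ≠ d) (hbc : b ≠ c) (hbd : b ≠ d)
    (hcd : c ≠ d) : Function.Injective (![a, b, c, d] : Fin 4 → ℕ) := by
  intro i j h
  fin_cases i <;> fin_cases j <;> simp_all [hab.symm, hac.symm, had.symm, hbc.symm, hbd.symm, hcd.symm]

/-- `∏ ![a, b, c, d] = a(b(cd))`. [folklore] -/
theorem prod_vecFour (a b c d : ℕ) : ∏ i, (![a, b, c, d] : Fin 4 → ℕ) i = a * (b * (c * d)) := by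
  simp [Fin.prod_univ_four]
  ring

/-- **The journal door for a four-term vector, odd product `a(b(cd))`**: Monsky (odd) + `det M = 1` + Burungale–Tian +
Deuring–Hecke + Burungale–Flach ⟹ `E_{a(b(cd))}` is square-free-indexed, has the BSD triple, analytic rank `0` and
`L(E_{a(b(cd))}, 1) ≠ 0` (the `k = 4` twin of `analyticRank_eq_zero_of_det_odd`).
[cite: HeathBrown1994SelmerCongruentII, Appendix (Monsky), typescript p. 39 L27–L33] [cite: BurungaleTian2026, Thm. 1.1]
[cite: BurungaleFlach2024, Thm. 1.1 and Cor. 2] -/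
theorem analyticRank_eq_zero_of_det_odd_four {a b c d : ℕ} (hM : monsky_card_selmerGroup_two_odd)
    (hBT : burungaleTian_analyticRank_eq_zero_of_selmerCorank_eq_zero_of_hasCM)
    (hH : hasEntireLFunction_of_j_mem_maximalCMJInvariants) (hBF : bsdTriple_of_hasCM_of_L_one_ne_zero)
    (ha : a.Prime) (hb : b.Prime) (hc : c.Prime) (hd : d.Prime)
    (ha2 : a % 2 = 1) (hb2 : b % 2 = 1) (hc2 : c % 2 = 1) (hd2 : d % 2 = 1)
    (hab : a ≠ b) (hac : a ≠ c) (had : a ≠ d) (hbc : b ≠ c) (hbd : b ≠ d) (hcd : c ≠ d)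
    (hdet : (monskyMatrixOdd ![a, b, c, d]).det = 1) :
    Squarefree (a * (b * (c * d))) ∧ (congruentNumberCurve (a * (b * (c * d)))).BSDTriple ∧
      (congruentNumberCurve (a * (b * (c * d)))).analyticRank = 0 ∧
      (congruentNumberCurve (a * (b * (c * d)))).entireLFunction 1 ≠ 0 := by
  have hprime : ∀ i, ((![a, b, c, d] : Fin 4 → ℕ) i).Prime := by
    intro i
    fin_cases i <;> assumption
  have hodd : ∀ i, Odd ((![a, b, c, d] : Fin 4 → ℕ) i) := by
    intro i
    fin_cases i
    · exact Nat.odd_iff.mpr ha2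
    · exact Nat.odd_iff.mpr hb2
    · exact Nat.odd_iff.mpr hc2
    · exact Nat.odd_iff.mpr hd2
  have hinj := vecFour_injective hab hac had hbc hbd hcd
  have h := bsdTriple_of_monsky_of_BT_BF_odd (![a, b, c, d] : Fin 4 → ℕ) hM hBT hH hBF hprime hodd hinj hdet
  have hsq0 := squarefree_prod_of_injective (![a, b, c, d] : Fin 4 → ℕ) hprime hinj
  have hprod := prod_vecFour a b c d
  rw [hprod] at hsq0
  simp only [hprod] at h
  obtain ⟨⟨hB, -, hA⟩, -⟩ := h
  haveI := isElliptic_congruentNumberCurve (Squarefree.ne_zero hsq0)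
  have hE : (congruentNumberCurve (a * (b * (c * d)))).HasEntireLFunction :=
    hH _ (congruentNumberCurve_j_mem_maximalCMJInvariants _)
  exact ⟨hsq0, hB, hA, ((congruentNumberCurve (a * (b * (c * d)))).analyticRank_eq_zero_iff_holds hE).mp hA⟩

/-! ## §2 Case A: the `(3,+)` pin + the free `(5,−)` prime + the universal cell -/

/-- Monotonicity of the class-number-formula majorant `x ↦ √x·log x` on `[1, ∞)`. [folklore] -/
theorem sqrt_mul_log_mono {x y : ℝ} (h1 : 1 ≤ x) (hxy : x ≤ y) :
    Real.sqrt x * Real.log x ≤ Real.sqrt y * Real.log y :=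
  mul_le_mul (Real.sqrt_le_sqrt hxy) (Real.log_le_log (by linarith) hxy) (Real.log_nonneg h1)
    (Real.sqrt_nonneg y)

/-- `(−ℓ₃ℓ₅/p) = +1` for `p ≡ 3 (mod 4)`, `(ℓ₃/p) = +1`, `(ℓ₅/p) = −1` (no primality needed). [folklore] -/
theorem jacobiSym_neg_pair_eq_one {p ℓ₃ ℓ₅ : ℕ} (hp4 : p % 4 = 3) (h3p : jacobiSym (ℓ₃ : ℤ) p = 1)
    (h5p : jacobiSym (ℓ₅ : ℤ) p = -1) : jacobiSym (-((ℓ₃ * ℓ₅ : ℕ) : ℤ)) p = 1 := by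
  have hm1 : jacobiSym (-1) p = -1 := DeuringLadic.jacobiSym_neg_one_of_mod_four hp4
  have : (-((ℓ₃ * ℓ₅ : ℕ) : ℤ)) = (-1) * (ℓ₃ : ℤ) * (ℓ₅ : ℤ) := by push_cast; ring
  rw [this, jacobiSym.mul_left, jacobiSym.mul_left, hm1, h3p, h5p]
  norm_num

/-- ★ **Case A of the card at one prime.** For a prime `p ≡ 7 (mod 8)` and a `(3,+)` prime `ℓ₃` (`ℓ₃ ≡ 3 (mod 8)`,
`(ℓ₃/p) = +1` — the Duke shrinking-disc pin, cf. `…ResiduePin.residuePin_of_shrinkingDisc`) with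
`π⁻¹·√(2pℓ₃)·log(2pℓ₃) < p`, modulo the five named facts: the conclusion of `HeegnerTwistCouplingInSupply` at `(E_p, p)` —
a Heegner field `K′ = ℚ(√−ℓ₃ℓ₅)` of `N(E_p) = 32p²` (`ℓ₅ < 2p` the tree's Siegel-free `(5,−)` prime, `threeSquaresPin`) with
`L(E_p^{(−ℓ₃ℓ₅)}, 1) ≠ 0` (universal cell `det M(p, ℓ₃, ℓ₅) = 1`) and `h(K′) < p`, so `p ∤ h(K′)`.
[cite: HeathBrown1994SelmerCongruentII, Appendix (Monsky), typescript p. 39 L27–L33] [cite: BurungaleTian2026, Thm. 1.1]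
[cite: BurungaleFlach2024, Thm. 1.1 and Cor. 2] [cite: KoblitzECMF1993, Ch. II §5, Theorem (p. 84)]
[cite: Oesterle1988Gauss, II §3 Proposition p. 57 (27)] -/
theorem cruxConclusion_caseA (hmod : ModularForms.exists_isNewformOf) (hM : monsky_card_selmerGroup_two_odd)
    (hBT : burungaleTian_analyticRank_eq_zero_of_selmerCorank_eq_zero_of_hasCM)
    (hH : hasEntireLFunction_of_j_mem_maximalCMJInvariants) (hBF : bsdTriple_of_hasCM_of_L_one_ne_zero)
    (p : ℕ) [Fact p.Prime] [(congruentNumberCurve p).IsElliptic] [(congruentNumberCurve p).IsGloballyMinimal]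
    [NeZero ((congruentNumberCurve p).conductorNorm ℤ)] (hp8 : p % 8 = 7)
    {ℓ₃ : ℕ} (h₃ : ℓ₃.Prime) (h38 : ℓ₃ % 8 = 3) (h3p : jacobiSym (ℓ₃ : ℤ) p = 1)
    (hsize : Real.pi⁻¹ * Real.sqrt ((2 * p * ℓ₃ : ℕ) : ℝ) * Real.log ((2 * p * ℓ₃ : ℕ) : ℝ) < p) :
    ∃ (K : Type) (_ : Field K) (_ : NumberField K),
      IsImaginaryQuadratic K ∧ 4 < (NumberField.discr K).natAbs ∧
      SatisfiesHeegnerHypothesis ((congruentNumberCurve p).conductorNorm ℤ) K ∧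
      ((congruentNumberCurve p).quadraticTwist (NumberField.discr K : ℚ)).entireLFunction 1 ≠ 0 ∧
      NumberField.classNumber K < p ∧ ¬ p ∣ NumberField.classNumber K := by
  have hp : p.Prime := Fact.out
  have hp4 : p % 4 = 3 := by omega
  -- the free `(5,−)` prime below `2p`
  obtain ⟨ℓ₅, h₅, h5lt, h58, h5p⟩ := threeSquaresPin p hp hp4
  -- the universal cell and the `L`-half
  have hdet := det_monskyMatrixOdd_cell_seven_mod_eight hp h₃ h₅ hp8 h38 h58 h5p
  have hp3 : p ≠ ℓ₃ := by rintro rfl; omega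
  have hp5 : p ≠ ℓ₅ := by rintro rfl; omega
  have h35 : ℓ₃ ≠ ℓ₅ := by rintro rfl; omega
  obtain ⟨-, -, -, hL⟩ := analyticRank_eq_zero_of_det_odd hM hBT hH hBF hp h₃ h₅ (by omega) (by omega) (by omega)
    hp3 hp5 h35 hdet
  -- the field half
  have hN : (congruentNumberCurve p).conductorNorm ℤ = 32 * p ^ 2 :=
    conductorNorm_congruentNumberCurve_of_odd hmod hp.squarefree (Nat.odd_iff.mpr (by omega))
  have h15 : 15 ≤ ℓ₃ * ℓ₅ := by
    have h3' : 3 ≤ ℓ₃ := by have := h₃.two_le; omega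
    have h5' : 5 ≤ ℓ₅ := by have := h₅.two_le; omega
    exact le_trans (by norm_num) (Nat.mul_le_mul h3' h5')
  have hx : Real.pi⁻¹ * Real.sqrt ((ℓ₃ * ℓ₅ : ℕ) : ℝ) * Real.log ((ℓ₃ * ℓ₅ : ℕ) : ℝ) < p := by
    refine lt_of_le_of_lt ?_ hsize
    have hle : ((ℓ₃ * ℓ₅ : ℕ) : ℝ) ≤ ((2 * p * ℓ₃ : ℕ) : ℝ) := by
      have : ℓ₃ * ℓ₅ ≤ 2 * p * ℓ₃ :=
        calc ℓ₃ * ℓ₅ ≤ ℓ₃ * (2 * p) := Nat.mul_le_mul_left ℓ₃ h5lt.le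
          _ = 2 * p * ℓ₃ := by ring
      exact_mod_cast this
    have h1 : (1 : ℝ) ≤ ((ℓ₃ * ℓ₅ : ℕ) : ℝ) := by exact_mod_cast (show 1 ≤ ℓ₃ * ℓ₅ by omega)
    rw [mul_assoc, mul_assoc]
    exact mul_le_mul_of_nonneg_left (sqrt_mul_log_mono h1 hle) (inv_nonneg.mpr Real.pi_pos.le)
  have hh := classNumber_lt_of_size_triple (p := p) (n := ℓ₃ * ℓ₅) (by omega) hx
  obtain ⟨K, iF, iN, hK, hdK, hH', hcl⟩ := exists_witnessField_of (N := (congruentNumberCurve p).conductorNorm ℤ)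
    h₃ h38 h₅ h58 (jacobiSym_neg_pair_eq_one hp4 h3p h5p) hh
    (fun r hr hrN => eq_two_or_eq_of_prime_dvd_thirtyTwo_mul_sq hp hr (hN ▸ hrN))
  refine ⟨K, iF, iN, hK, ?_, hH', ?_, hcl, ?_⟩
  · rw [hdK, Int.natAbs_neg, Int.natAbs_natCast]
    omega
  · rw [hdK, quadraticTwist_congruentNumberCurve, Int.natAbs_neg, Int.natAbs_natCast]
    exact hL
  · exact fun hdvd => absurd (Nat.le_of_dvd (NumberField.classNumber_pos K) hdvd) (not_le.mpr hcl)

/-! ## §3 Case B: the all-nonresidue bilinear triple + the nonresidue cell -/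

/-- ★ **Case B of the card at one prime.** For a prime `p ≡ 7 (mod 8)` and primes `ℓ₁ ≡ 1`, `ℓ₃ ≡ 3`, `ℓ₅ ≡ 5 (mod 8)` with
`(ℓ₁/p) = (ℓ₃/p) = (ℓ₅/p) = −1`, `(ℓ₁/ℓ₃) = +1` (the Heath-Brown bilinear supply) and `π⁻¹·√(ℓ₁ℓ₃ℓ₅)·log(ℓ₁ℓ₃ℓ₅) < p`,
modulo the five named facts: the conclusion of `HeegnerTwistCouplingInSupply` at `(E_p, p)` with `K′ = ℚ(√−ℓ₁ℓ₃ℓ₅)`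
(`det M(p, ℓ₁, ℓ₃, ℓ₅) = 1` by `det_monskyMatrixOdd_nonresidueCell`, so `L(E_p^{(−ℓ₁ℓ₃ℓ₅)}, 1) ≠ 0`; Heegner for `32p²`;
`h(K′) < p`). [cite: HeathBrown1994SelmerCongruentII, Appendix (Monsky), typescript p. 39 L27–L33] [cite: BurungaleTian2026, Thm. 1.1]
[cite: BurungaleFlach2024, Thm. 1.1 and Cor. 2] [cite: KoblitzECMF1993, Ch. II §5, Theorem (p. 84)]
[cite: Oesterle1988Gauss, II §3 Proposition p. 57 (27)] -/
theorem cruxConclusion_caseB (hmod : ModularForms.exists_isNewformOf) (hM : monsky_card_selmerGroup_two_odd)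
    (hBT : burungaleTian_analyticRank_eq_zero_of_selmerCorank_eq_zero_of_hasCM)
    (hH : hasEntireLFunction_of_j_mem_maximalCMJInvariants) (hBF : bsdTriple_of_hasCM_of_L_one_ne_zero)
    (p : ℕ) [Fact p.Prime] [(congruentNumberCurve p).IsElliptic] [(congruentNumberCurve p).IsGloballyMinimal]
    [NeZero ((congruentNumberCurve p).conductorNorm ℤ)] (hp8 : p % 8 = 7)
    {ℓ₁ ℓ₃ ℓ₅ : ℕ} (h₁ : ℓ₁.Prime) (h₃ : ℓ₃.Prime) (h₅ : ℓ₅.Prime)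
    (h18 : ℓ₁ % 8 = 1) (h38 : ℓ₃ % 8 = 3) (h58 : ℓ₅ % 8 = 5)
    (h1p : jacobiSym (ℓ₁ : ℤ) p = -1) (h3p : jacobiSym (ℓ₃ : ℤ) p = -1) (h5p : jacobiSym (ℓ₅ : ℤ) p = -1)
    (h13 : jacobiSym (ℓ₁ : ℤ) ℓ₃ = 1)
    (hsize : Real.pi⁻¹ * Real.sqrt ((ℓ₁ * ℓ₃ * ℓ₅ : ℕ) : ℝ) * Real.log ((ℓ₁ * ℓ₃ * ℓ₅ : ℕ) : ℝ) < p) :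
    ∃ (K : Type) (_ : Field K) (_ : NumberField K),
      IsImaginaryQuadratic K ∧ 4 < (NumberField.discr K).natAbs ∧
      SatisfiesHeegnerHypothesis ((congruentNumberCurve p).conductorNorm ℤ) K ∧
      ((congruentNumberCurve p).quadraticTwist (NumberField.discr K : ℚ)).entireLFunction 1 ≠ 0 ∧
      NumberField.classNumber K < p ∧ ¬ p ∣ NumberField.classNumber K := by
  have hp : p.Prime := Fact.out
  have hp4 : p % 4 = 3 := by omega
  -- the nonresidue cell and the `L`-half
  have hdet := det_monskyMatrixOdd_nonresidueCell hp h₁ h₃ h₅ hp8 h18 h38 h58 h1p h3p h5p h13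
  have hp1 : p ≠ ℓ₁ := by rintro rfl; omega
  have hp3 : p ≠ ℓ₃ := by rintro rfl; omega
  have hp5 : p ≠ ℓ₅ := by rintro rfl; omega
  have h13' : ℓ₁ ≠ ℓ₃ := by rintro rfl; omega
  have h15 : ℓ₁ ≠ ℓ₅ := by rintro rfl; omega
  have h35 : ℓ₃ ≠ ℓ₅ := by rintro rfl; omega
  obtain ⟨-, -, -, hL⟩ := analyticRank_eq_zero_of_det_odd_four hM hBT hH hBF hp h₁ h₃ h₅ (by omega) (by omega)
    (by omega) (by omega) hp1 hp3 hp5 h13' h15 h35 hdet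
  -- the field half
  have hN : (congruentNumberCurve p).conductorNorm ℤ = 32 * p ^ 2 :=
    conductorNorm_congruentNumberCurve_of_odd hmod hp.squarefree (Nat.odd_iff.mpr (by omega))
  have h4 : 4 < ℓ₁ * ℓ₃ * ℓ₅ := by
    have h8 : 2 * 2 * 2 ≤ ℓ₁ * ℓ₃ * ℓ₅ := Nat.mul_le_mul (Nat.mul_le_mul h₁.two_le h₃.two_le) h₅.two_le
    omega
  have hh := classNumber_lt_of_size_triple (p := p) (n := ℓ₁ * ℓ₃ * ℓ₅) h4 hsize
  obtain ⟨K, iF, iN, hK, hdK, hH', hcl⟩ := exists_witnessField_triple (N := (congruentNumberCurve p).conductorNorm ℤ)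
    h₁ h18 h₃ h38 h₅ h58 (jacobiSym_neg_triple_eq_one hp4 h1p h3p h5p) hh
    (fun r hr hrN => eq_two_or_eq_of_prime_dvd_thirtyTwo_mul_sq hp hr (hN ▸ hrN))
  refine ⟨K, iF, iN, hK, ?_, hH', ?_, hcl, ?_⟩
  · rw [hdK, Int.natAbs_neg, Int.natAbs_natCast]
    exact h4
  · rw [hdK, quadraticTwist_congruentNumberCurve, Int.natAbs_neg, Int.natAbs_natCast,
      show p * (ℓ₁ * ℓ₃ * ℓ₅) = p * (ℓ₁ * (ℓ₃ * ℓ₅)) by ring]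
    exact hL
  · exact fun hdvd => absurd (Nat.le_of_dvd (NumberField.classNumber_pos K) hdvd) (not_le.mpr hcl)

/-! ## §4 The switch: the card's target `EpCornerAllLargeP` from the two supplies -/

/-- ★ **The class-number SWITCH (the card's `FirstLemma`, kernel form).** Let `C` be any predicate on primes (in the card:
`C p :⟺ h(−4p) ≥ p^{1/2−η}`). Suppose SUPPLY A: beyond `p₀`, every prime `p ≡ 7 (mod 8)` with `C p` has a `(3,+)` prime `ℓ₃`
with `π⁻¹√(2pℓ₃)·log(2pℓ₃) < p` (size-effective form of the Duke pin `ℓ₃ ≤ p^{1−δ}`); and SUPPLY B: beyond `p₀′`, every prime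
`p ≡ 7 (mod 8)` with `¬ C p` has an all-nonresidue triple `ℓ₁, ℓ₃, ℓ₅` (`≡ 1, 3, 5 (mod 8)`, `(ℓᵢ/p) = −1`, `(ℓ₁/ℓ₃) = +1`) with
`π⁻¹√(ℓ₁ℓ₃ℓ₅)·log(ℓ₁ℓ₃ℓ₅) < p` (size-effective form of `ℓ₁ℓ₃ℓ₅ ≤ 16p^{3/2+3ε}`). Then, modulo the five named facts, the
conclusion of `HeegnerTwistCouplingInSupply` holds on `W = E_p` for EVERY prime `p ≡ 7 (mod 8)` beyond `max p₀ p₀′` — with no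
side condition on `p mod 3, 5` (the card's `EpCornerAllLargeP`). [cite: HeathBrown1994SelmerCongruentII, Appendix (Monsky), typescript p. 39 L27–L33]
[cite: BurungaleTian2026, Thm. 1.1] [cite: BurungaleFlach2024, Thm. 1.1 and Cor. 2] [cite: KoblitzECMF1993, Ch. II §5, Theorem (p. 84)] -/
theorem epCornerAllLargeP_of_supplies (hmod : ModularForms.exists_isNewformOf) (hM : monsky_card_selmerGroup_two_odd)
    (hBT : burungaleTian_analyticRank_eq_zero_of_selmerCorank_eq_zero_of_hasCM)
    (hH : hasEntireLFunction_of_j_mem_maximalCMJInvariants) (hBF : bsdTriple_of_hasCM_of_L_one_ne_zero)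
    (C : ℕ → Prop) {p₀ p₀' : ℕ}
    (hA : ∀ p : ℕ, p.Prime → p₀ ≤ p → p % 8 = 7 → C p →
      ∃ ℓ₃ : ℕ, ℓ₃.Prime ∧ ℓ₃ % 8 = 3 ∧ jacobiSym (ℓ₃ : ℤ) p = 1 ∧
        Real.pi⁻¹ * Real.sqrt ((2 * p * ℓ₃ : ℕ) : ℝ) * Real.log ((2 * p * ℓ₃ : ℕ) : ℝ) < p)
    (hB : ∀ p : ℕ, p.Prime → p₀' ≤ p → p % 8 = 7 → ¬ C p →
      ∃ ℓ₁ ℓ₃ ℓ₅ : ℕ, ℓ₁.Prime ∧ ℓ₃.Prime ∧ ℓ₅.Prime ∧ ℓ₁ % 8 = 1 ∧ ℓ₃ % 8 = 3 ∧ ℓ₅ % 8 = 5 ∧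
        jacobiSym (ℓ₁ : ℤ) p = -1 ∧ jacobiSym (ℓ₃ : ℤ) p = -1 ∧ jacobiSym (ℓ₅ : ℤ) p = -1 ∧
        jacobiSym (ℓ₁ : ℤ) ℓ₃ = 1 ∧
        Real.pi⁻¹ * Real.sqrt ((ℓ₁ * ℓ₃ * ℓ₅ : ℕ) : ℝ) * Real.log ((ℓ₁ * ℓ₃ * ℓ₅ : ℕ) : ℝ) < p) :
    ∃ p₁ : ℕ, ∀ (p : ℕ) [Fact p.Prime] [(congruentNumberCurve p).IsElliptic]
      [(congruentNumberCurve p).IsGloballyMinimal] [NeZero ((congruentNumberCurve p).conductorNorm ℤ)],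
      p₁ ≤ p → p % 8 = 7 →
      ∃ (K : Type) (_ : Field K) (_ : NumberField K),
        IsImaginaryQuadratic K ∧ 4 < (NumberField.discr K).natAbs ∧
        SatisfiesHeegnerHypothesis ((congruentNumberCurve p).conductorNorm ℤ) K ∧
        ((congruentNumberCurve p).quadraticTwist (NumberField.discr K : ℚ)).entireLFunction 1 ≠ 0 ∧
        NumberField.classNumber K < p ∧ ¬ p ∣ NumberField.classNumber K := by
  classical
  refine ⟨max p₀ p₀', fun p hpF _ _ _ hp₁ hp8 => ?_⟩
  have hp : p.Prime := hpF.out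
  by_cases hC : C p
  · obtain ⟨ℓ₃, h₃, h38, h3p, hsize⟩ := hA p hp (le_trans (le_max_left _ _) hp₁) hp8 hC
    exact cruxConclusion_caseA hmod hM hBT hH hBF p hp8 h₃ h38 h3p hsize
  · obtain ⟨ℓ₁, ℓ₃, ℓ₅, h₁, h₃, h₅, h18, h38, h58, h1p, h3p, h5p, h13, hsize⟩ :=
      hB p hp (le_trans (le_max_right _ _) hp₁) hp8 hC
    exact cruxConclusion_caseB hmod hM hBT hH hBF p hp8 h₁ h₃ h₅ h18 h38 h58 h1p h3p h5p h13 hsize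

end Summit.BirchSwinnertonDyer.BirchSwinnertonDyer.Theorems.DukeBilinearCells
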